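/-
Copyright (c) 2026 the pub-hodgecm-mathlib formalisation cell (harness21).  Prover seat hodgecm-mathlib-K2Liu-p11 (g3), Track B «K2-LIT»,
#184♮ = hLiu418 = `stmt-HodgeConjecture-24832`; #41 G6-arch (A∞), ASSEMBLY FILE 1: THE SIEGEL LAW OF `M_w(s) F` FOR EVERY SECTION `F ∈ I_w(s, χ_k)` (the `hG` binder of
★ (H2-alg) `rung_step` for `G := M_w F_i` on every rung).  THEOREMS ONLY (no `def`, no `instance`, no notation, no named-fact hypothesis, no `sorry`).
-/
import Summits.HodgeConjecture.HodgeConjecture.Theorems.K2LiuArchWhittakerLeviEquivariance    -- ★ (V-L1) `integral_comp_hermTwo_conj`, `J_mul_transl_mul_levi`, `levi_mem`, `norm_det_levi`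
import Summits.HodgeConjecture.HodgeConjecture.Theorems.K2LiuArchIntertwiningScalarSection    -- ★ (A∞-R) `integral_translate` (brings ★ `integral_hermOfReal_eq`)
import HarnessLib

/-!
# Crux `HLiu418`, G6-arch (A∞), assembly FILE 1: `M_w(s)` maps `I_w(s, χ_k)` to `I_w(−s, χ_k)` — the Siegel law of `y ↦ M_w F (y)` for EVERY section `F`

Cell `hodgecm-mathlib`, crux item hLiu418 = `stmt-HodgeConjecture-24832` (helper lane `--supports`, count-neutral); squad K2 ∕ K2Liu, prover K2Liu-p11 (g3).

★ (A∞-R) `archIntertwining_eq_archScalarCoeff_mul` gives `M_w(s) f⁰_{s,k} = c_k(s) f⁰_{−s,k}` for the scalar-type vector by EVALUATION.  The `K_w`-type ladder (★ (H2-alg)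
`rung_step`, binder `hG : IsArchSiegelSection χ_k (−s) G` with `G := M_w F_i`) needs the PARABOLIC LAW of `M_w F` for every rung `F_i`.  This file proves it for EVERY
`F ∈ I_w(s, χ_k)` and EVERY argument (no convergence needed: all three changes of variables are identities of Bochner integrals for arbitrary integrands):
for `p = n(B)·m(a, d) ∈ P_Δ` (`p₂₁ = 0`, `aᴴd = 1`, `B = p₁₂ d⁻¹` Hermitian),
`M_w F (p g) = ∫ F(J n(X) n(B) m(a,d) g) dX = χ_k(det d)‖det d‖^{2s+2} ∫ F(J n(dᴴ(X+B)d) g) dX` (★ `J_mul_transl_mul_levi` + the law of `F` at `m(d,a)`)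
`= χ_k(det d)‖det d‖^{2s+2}·‖det d‖^{−4} · M_w F (g)` (Haar translation ★ `integral_translate`; Levi substitution ★ `integral_comp_hermTwo_conj` through the chart constant ★
`integral_hermOfReal_eq`) `= χ_k(det a)‖det a‖^{−2s+2} · M_w F (g)` (`det a = (conj det d)⁻¹`, `χ_k((conj w)⁻¹) = χ_k(w)`).
* §1 the Siegel decomposition `p = n(p₁₂ p₂₂⁻¹) · m(p₁₁, p₂₂)` and its letters; §2 the scalar identity; §3 **`isArchSiegelSection_archIntertwining`**.
References: [Shimura1997, §16.4]; [Knapp1986, Ch. VII §§3–4]; [Shimura1982, (1.17)].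
HONEST LABEL: HC_CM is proved only modulo the 7 printed citations (2 remaining named inputs: hLiu418 = stmt-HodgeConjecture-24832,
h413 = stmt-HodgeConjecture-24833) until rung 0 closes; count-neutral helper, closes no socket.
-/

set_option autoImplicit false
set_option linter.dupNamespace false

noncomputable section

open Complex Matrix MeasureTheory
open scoped ComplexConjugate ComplexOrder

namespace Summit.HodgeConjecture.HodgeConjecture.Cruxes.HLiu418.K2LiuArchIntertwiningSiegelLaw

open Summit.HodgeConjecture.HodgeConjecture.Cruxes.HLiu418.K2LiuHermTwoGammaDefs
open Summit.HodgeConjecture.HodgeConjecture.Cruxes.HLiu418.K2LiuHermitianTubeCocycle (blocks_rel transl_mul_transl)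
open Summit.HodgeConjecture.HodgeConjecture.Cruxes.HLiu418.K2LiuArchInducedTubeDefs
open Summit.HodgeConjecture.HodgeConjecture.Cruxes.HLiu418.K2LiuArchWhittakerLeviEquivariance (integral_comp_hermTwo_conj J_mul_transl_mul_levi levi_mem norm_det_levi)
open Summit.HodgeConjecture.HodgeConjecture.Cruxes.HLiu418.K2LiuArchIntertwiningScalarValue (integral_hermOfReal_eq)
open Summit.HodgeConjecture.HodgeConjecture.Cruxes.HLiu418.K2LiuArchIntertwiningScalarSection (integral_translate)

/-! ## §1 The Siegel decomposition of `p ∈ P_Δ` -/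

/-- **`p = n(p₁₂ p₂₂⁻¹) · m(p₁₁, p₂₂)` for `p ∈ U(J)` with `p₂₁ = 0`**, with `p₁₁ᴴ p₂₂ = 1`, `det p₂₂ ≠ 0` and `p₁₂ p₂₂⁻¹` Hermitian. [Shimura1997, §5.1] -/
theorem siegel_decomposition {l : Type*} [Fintype l] [DecidableEq l] {p : Matrix (l ⊕ l) (l ⊕ l) ℂ} (hp : pᴴ * Matrix.J l ℂ * p = Matrix.J l ℂ)
    (hp21 : p.toBlocks₂₁ = 0) :
    p.toBlocks₁₁ᴴ * p.toBlocks₂₂ = 1 ∧ p.toBlocks₂₂.det ≠ 0 ∧ (p.toBlocks₁₂ * p.toBlocks₂₂⁻¹)ᴴ = p.toBlocks₁₂ * p.toBlocks₂₂⁻¹ ∧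
      p = fromBlocks 1 (p.toBlocks₁₂ * p.toBlocks₂₂⁻¹) 0 1 * fromBlocks p.toBlocks₁₁ 0 0 p.toBlocks₂₂ := by
  obtain ⟨-, h2, h3, -⟩ := blocks_rel hp
  rw [hp21, conjTranspose_zero, Matrix.zero_mul, sub_zero] at h3
  -- `h3 : p₁₁ᴴ p₂₂ = 1`
  have hdu : IsUnit p.toBlocks₂₂.det := by
    have h := congrArg Matrix.det h3
    rw [det_mul, det_one] at h
    exact isUnit_iff_ne_zero.2 (right_ne_zero_of_mul_eq_one h)
  have hd : p.toBlocks₂₂.det ≠ 0 := hdu.ne_zero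
  refine ⟨h3, hd, ?_, ?_⟩
  · -- `(b d⁻¹)ᴴ = d⁻ᴴ bᴴ = b d⁻¹` from `bᴴ d = dᴴ b`
    rw [conjTranspose_mul, conjTranspose_nonsing_inv]
    have hdHu : IsUnit p.toBlocks₂₂ᴴ.det := by rw [det_conjTranspose]; exact hdu.star
    have key : p.toBlocks₂₂ᴴ⁻¹ * p.toBlocks₁₂ᴴ * p.toBlocks₂₂ = p.toBlocks₁₂ := by
      rw [Matrix.mul_assoc, h2, ← Matrix.mul_assoc, Matrix.nonsing_inv_mul _ hdHu, Matrix.one_mul]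
    calc p.toBlocks₂₂ᴴ⁻¹ * p.toBlocks₁₂ᴴ = p.toBlocks₂₂ᴴ⁻¹ * p.toBlocks₁₂ᴴ * p.toBlocks₂₂ * p.toBlocks₂₂⁻¹ := by
          rw [Matrix.mul_assoc (p.toBlocks₂₂ᴴ⁻¹ * p.toBlocks₁₂ᴴ), Matrix.mul_nonsing_inv _ hdu, Matrix.mul_one]
      _ = p.toBlocks₁₂ * p.toBlocks₂₂⁻¹ := by rw [key]
  · conv_lhs => rw [← fromBlocks_toBlocks p]
    rw [hp21, fromBlocks_multiply]
    simp only [Matrix.one_mul, Matrix.mul_zero, add_zero, Matrix.zero_mul, zero_add, Matrix.nonsing_inv_mul_cancel_right _ _ hdu]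

/-! ## §2 The scalar identity -/

/-- `χ_k((conj w)⁻¹-type partner) = χ_k(w)`: for `conj z · w = 1`, `(z̄∕‖z‖)^k = (w̄∕‖w‖)^k`. [folklore] -/
theorem chi_partner (k : ℤ) {z w : ℂ} (h : conj z * w = 1) :
    (conj z / ((‖z‖ : ℝ) : ℂ)) ^ k = (conj w / ((‖w‖ : ℝ) : ℂ)) ^ k := by
  have hw : w ≠ 0 := fun h0 => by rw [h0, mul_zero] at h; exact zero_ne_one h
  have hz : z ≠ 0 := fun h0 => by rw [h0, map_zero, zero_mul] at h; exact zero_ne_one h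
  have hcz : conj z = w⁻¹ := eq_inv_of_mul_eq_one_left h
  have hnz : ‖z‖ = ‖w‖⁻¹ := by
    have := congrArg norm hcz
    rwa [norm_conj, norm_inv] at this
  have hwn : ((‖w‖ : ℝ) : ℂ) ≠ 0 := Complex.ofReal_ne_zero.2 (norm_ne_zero_iff.2 hw)
  have hww : w * conj w = ((‖w‖ : ℝ) : ℂ) ^ 2 := by rw [Complex.mul_conj, Complex.normSq_eq_norm_sq, Complex.ofReal_pow]
  congr 1
  rw [hcz, hnz, Complex.ofReal_inv, inv_div_inv, div_eq_div_iff hw hwn, ← sq, ← hww, mul_comm]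

/-- **THE SCALAR OF THE LAW**: `χ_k(det d)·‖det d‖^{2s+2}·(‖det d‖⁴)⁻¹ • Y = χ_k(det a)·‖det a‖^{2(−s)+2}·Y` for `aᴴ d = 1`. [Shimura1997, §16.4] -/
theorem levi_scalar_identity (k : ℤ) (s : ℂ) {a d : Matrix (Fin 2) (Fin 2) ℂ} (had : aᴴ * d = 1) (Y : ℂ) :
    (conj d.det / ((‖d.det‖ : ℝ) : ℂ)) ^ k * ((‖d.det‖ : ℝ) : ℂ) ^ (2 * s + (Fintype.card (Fin 2) : ℂ)) * ((‖d.det‖ ^ 4)⁻¹ • Y) =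
      (conj a.det / ((‖a.det‖ : ℝ) : ℂ)) ^ k * ((‖a.det‖ : ℝ) : ℂ) ^ (2 * (-s) + (Fintype.card (Fin 2) : ℂ)) * Y := by
  obtain ⟨ha0, hnd⟩ := norm_det_levi had
  have hdet : conj a.det * d.det = 1 := by
    have h := congrArg Matrix.det had
    rwa [det_mul, det_conjTranspose, det_one] at h
  have hd0 : d.det ≠ 0 := fun h0 => by rw [h0, mul_zero] at hdet; exact zero_ne_one hdet
  have hna : ‖a.det‖ = ‖d.det‖⁻¹ := by rw [hnd, inv_inv]
  have hx0 : ((‖d.det‖ : ℝ) : ℂ) ≠ 0 := Complex.ofReal_ne_zero.2 (norm_ne_zero_iff.2 hd0)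
  have hxpos : 0 < ‖d.det‖ := norm_pos_iff.2 hd0
  have harg : ((‖d.det‖ : ℝ) : ℂ).arg ≠ Real.pi := by
    rw [Complex.arg_ofReal_of_nonneg hxpos.le]; exact Real.pi_ne_zero.symm
  have e1 : ((‖a.det‖ : ℝ) : ℂ) ^ (2 * (-s) + (2 : ℂ)) = ((‖d.det‖ : ℝ) : ℂ) ^ (2 * s - 2) := by
    rw [hna, Complex.ofReal_inv, Complex.inv_cpow _ _ harg, ← Complex.cpow_neg]
    congr 1
    ring
  have e2 : ((‖d.det‖ : ℝ) : ℂ) ^ (2 * s + (2 : ℂ)) * (((‖d.det‖ ^ 4)⁻¹ : ℝ) : ℂ) = ((‖d.det‖ : ℝ) : ℂ) ^ (2 * s - 2) := by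
    rw [Complex.ofReal_inv, Complex.ofReal_pow, ← Complex.cpow_natCast, ← Complex.cpow_neg, ← Complex.cpow_add _ _ hx0]
    congr 1
    push_cast
    ring
  rw [chi_partner k hdet, Fintype.card_fin, Nat.cast_ofNat, Complex.real_smul, e1, ← e2]
  ring

/-! ## §3 The Siegel law of `M_w F` -/

/-- **`M_w(s)` MAPS `I_w(s, χ_k)` TO `I_w(−s, χ_k)`**: for EVERY `F` with the parabolic law of `I_w(s, χ_k)`, the function `y ↦ M_w F (y) = ∫ F(J n(X) y) dX` has the
parabolic law of `I_w(−s, χ_k)` at EVERY argument (translation + Levi substitution in the integral; the `hG` binder of ★ (H2-alg) `rung_step` for `G := M_w F_i`).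
[Shimura1997, §16.4] [Knapp1986, Ch. VII §4] -/
theorem isArchSiegelSection_archIntertwining (k : ℤ) (s : ℂ) {F : Matrix (Fin 2 ⊕ Fin 2) (Fin 2 ⊕ Fin 2) ℂ → ℂ}
    (hF : IsArchSiegelSection (fun z : ℂ => (conj z / ((‖z‖ : ℝ) : ℂ)) ^ k) s F) :
    IsArchSiegelSection (fun z : ℂ => (conj z / ((‖z‖ : ℝ) : ℂ)) ^ k) (-s) (fun y => archIntertwining F y) := by
  intro p g hp hp21
  obtain ⟨had, hd0, hB, hpeq⟩ := siegel_decomposition hp hp21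
  set a : Matrix (Fin 2) (Fin 2) ℂ := p.toBlocks₁₁ with ha
  set d : Matrix (Fin 2) (Fin 2) ℂ := p.toBlocks₂₂ with hd
  set B : Matrix (Fin 2) (Fin 2) ℂ := p.toBlocks₁₂ * p.toBlocks₂₂⁻¹ with hBdef
  show archIntertwining F (p * g) = _ * archIntertwining F g
  rw [archIntertwining_apply, archIntertwining_apply]
  -- (1) the integrand at `p g`: the law of `F` at `m(d, a)`
  have hlaw : ∀ X : Matrix (Fin 2) (Fin 2) ℂ, F (Matrix.J (Fin 2) ℂ * fromBlocks 1 X 0 1 * (p * g)) =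
      (conj d.det / ((‖d.det‖ : ℝ) : ℂ)) ^ k * ((‖d.det‖ : ℝ) : ℂ) ^ (2 * s + (Fintype.card (Fin 2) : ℂ)) *
        F (Matrix.J (Fin 2) ℂ * fromBlocks 1 (dᴴ * (X + B) * d) 0 1 * g) := by
    intro X
    have hmat : Matrix.J (Fin 2) ℂ * fromBlocks 1 X 0 1 * (p * g) = fromBlocks d 0 0 a * (Matrix.J (Fin 2) ℂ * fromBlocks 1 (dᴴ * (X + B) * d) 0 1 * g) := by
      rw [hpeq]
      calc Matrix.J (Fin 2) ℂ * fromBlocks 1 X 0 1 * (fromBlocks 1 B 0 1 * fromBlocks a 0 0 d * g)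
          = Matrix.J (Fin 2) ℂ * (fromBlocks 1 X 0 1 * fromBlocks 1 B 0 1) * fromBlocks a 0 0 d * g := by simp only [Matrix.mul_assoc]
        _ = fromBlocks d 0 0 a * (Matrix.J (Fin 2) ℂ * fromBlocks 1 (dᴴ * (X + B) * d) 0 1) * g := by rw [transl_mul_transl, J_mul_transl_mul_levi had]
        _ = fromBlocks d 0 0 a * (Matrix.J (Fin 2) ℂ * fromBlocks 1 (dᴴ * (X + B) * d) 0 1 * g) := by simp only [Matrix.mul_assoc]
    rw [hmat, hF (fromBlocks d 0 0 a) _ (levi_mem had) (toBlocks_fromBlocks₂₁ d 0 0 a), toBlocks_fromBlocks₁₁]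
  simp only [hlaw]
  rw [integral_const_mul]
  -- (2) translation by `B`, (3) Levi substitution through the `hermTwo` chart
  have htrans : ∫ r : Fin 2 → Fin 2 → ℝ, F (Matrix.J (Fin 2) ℂ * fromBlocks 1 (dᴴ * (hermOfReal r + B) * d) 0 1 * g) =
      ∫ r : Fin 2 → Fin 2 → ℝ, F (Matrix.J (Fin 2) ℂ * fromBlocks 1 (dᴴ * hermOfReal r * d) 0 1 * g) :=
    integral_translate hB (fun X => F (Matrix.J (Fin 2) ℂ * fromBlocks 1 (dᴴ * X * d) 0 1 * g))
  have hdH : dᴴ.det ≠ 0 := by rw [det_conjTranspose]; exact (star_ne_zero).2 hd0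
  have hsub : ∫ r : Fin 2 → Fin 2 → ℝ, F (Matrix.J (Fin 2) ℂ * fromBlocks 1 (dᴴ * hermOfReal r * d) 0 1 * g) =
      (‖d.det‖ ^ 4)⁻¹ • ∫ r : Fin 2 → Fin 2 → ℝ, F (Matrix.J (Fin 2) ℂ * fromBlocks 1 (hermOfReal r) 0 1 * g) := by
    have h1 := integral_comp_hermTwo_conj hdH (fun X => F (Matrix.J (Fin 2) ℂ * fromBlocks 1 X 0 1 * g))
    simp only [conjTranspose_conjTranspose] at h1
    -- `h1 : ∫ c, F(J n(hermTwo c) g) = ‖det dᴴ‖⁴ • ∫ c, F(J n(dᴴ hermTwo c d) g)`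
    have hn : ‖dᴴ.det‖ = ‖d.det‖ := by rw [det_conjTranspose, norm_star]
    rw [hn] at h1
    have hpow : (‖d.det‖ ^ 4 : ℝ) ≠ 0 := pow_ne_zero 4 (norm_ne_zero_iff.2 hd0)
    rw [integral_hermOfReal_eq (fun X => F (Matrix.J (Fin 2) ℂ * fromBlocks 1 (dᴴ * X * d) 0 1 * g)),
      integral_hermOfReal_eq (fun X => F (Matrix.J (Fin 2) ℂ * fromBlocks 1 X 0 1 * g)), h1, mul_smul_comm, smul_smul, inv_mul_cancel₀ hpow, one_smul]
  rw [htrans, hsub]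
  exact levi_scalar_identity k s had _

end Summit.HodgeConjecture.HodgeConjecture.Cruxes.HLiu418.K2LiuArchIntertwiningSiegelLaw

end
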